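import Literature.Topology.FourManifolds.SurfaceGroupNielsenCoreFrame
import HarnessLib

/-!
# Rotations of simple circuits are simple circuits

Topic `Literature/Topology/FourManifolds`.  The small closure property `SimpleCircuitRotate g`
of the CORE frame (`SurfaceGroupNielsenCoreFrame.lean`): if a word `w` is a simple circuit in the
Cayley graph of `S_g` (`IsSimpleCircuit`: non-empty, reduced, closed, with pairwise distinct
prefix vertices) then so is every rotation `w.rotate k` — the rotated path is the same closed
path read from another of its vertices: its prefix vertices are `P_k⁻¹ P_{(k+i) mod n}`.  On
the way: a simple circuit is cyclically reduced.

## References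

* H. Zieschang, E. Vogt, H.-D. Coldewey, *Surfaces and Planar Discontinuous Groups*, LNM 835
  (1980), 5.3.1 (c). [ZieschangVogtColdewey1980]
-/

noncomputable section

namespace Literature.Topology.FourManifolds

open Literature.GroupTheory.CombinatorialGroupTheory List

namespace SurfaceGroup

variable {g : ℕ}

/-- Prefix vertices of a word. [folklore] -/
def pv (g : ℕ) (w : List (surfaceGen g × Bool)) (i : ℕ) : SurfaceGroup g :=
  proj g (FreeGroup.mk (w.take i))

/-- The prefix vertex at the full length of a closed word is `1`. [folklore] -/
theorem pv_length {w : List (surfaceGen g × Bool)} (hw : proj g (FreeGroup.mk w) = 1) :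
    pv g w w.length = 1 := by
  simp [pv, hw]

/-- `pv` at `0`. [folklore] -/
theorem pv_zero (w : List (surfaceGen g × Bool)) : pv g w 0 = 1 := by
  simp only [pv, List.take_zero]
  exact map_one (proj g)

/-- **A simple circuit is cyclically reduced**: its last and first letters do not cancel (else
the vertex after the first letter would coincide with the vertex before the last one).
[folklore] -/
theorem IsSimpleCircuit.isCyclicallyReduced {w : List (surfaceGen g × Bool)}
    (hw : IsSimpleCircuit (g := g) w) : FreeGroup.IsCyclicallyReduced w := by
  obtain ⟨hne, hred, hcl, hinj⟩ := hw
  refine ⟨hred, ?_⟩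
  intro a ha b hb hab
  -- `w = b :: M ++ [a]` unless it has one letter
  by_contra hne2
  have hlen : 2 ≤ w.length := by
    rcases w with _ | ⟨x, _ | ⟨y, t⟩⟩
    · exact absurd rfl hne
    · -- one letter: `a = b = x`, contradiction with `hne2`
      simp only [List.getLast?_singleton, Option.mem_def, Option.some.injEq, List.head?_cons] at ha hb
      subst ha; subst hb
      exact absurd rfl hne2
    · simp
  -- the vertex after the first letter equals the vertex before the last letter
  have hb' : w.head? = some b := hb
  have ha' : w.getLast? = some a := ha
  have hfirst : w.take 1 = [b] := by
    rcases w with _ | ⟨x, t⟩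
    · exact absurd rfl hne
    · simp only [List.head?_cons, Option.some.injEq] at hb'
      simp [hb']
  have hlast : w = w.take (w.length - 1) ++ [a] := by
    have h1 : w.getLast? = some (w.getLast hne) := List.getLast?_eq_some_getLast hne
    rw [h1] at ha'
    simp only [Option.some.injEq] at ha'
    rw [← List.dropLast_eq_take, ← ha', List.dropLast_append_getLast hne]
  have hcancel : FreeGroup.mk [b] * FreeGroup.mk (w.drop 1) = FreeGroup.mk w := by
    rw [← mk_append, ← hfirst, List.take_append_drop]
  -- `proj (take (n-1)) = proj (mk w) * proj [a]⁻¹ = proj [a]⁻¹` and `proj (take 1) = proj [b]`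
  have h1 : pv g w 1 = proj g (FreeGroup.mk [b]) := by rw [pv, hfirst]
  have h2 : pv g w (w.length - 1) = (proj g (FreeGroup.mk [a]))⁻¹ := by
    have : FreeGroup.mk w = FreeGroup.mk (w.take (w.length - 1)) * FreeGroup.mk [a] := by
      conv_lhs => rw [hlast]
      rw [mk_append]
    have hh := congrArg (proj g) this
    rw [hcl, map_mul] at hh
    rw [pv]
    exact eq_inv_of_mul_eq_one_left hh.symm
  have hab' : proj g (FreeGroup.mk [b]) = (proj g (FreeGroup.mk [a]))⁻¹ := by
    -- `a` and `b` are inverse letters: same symbol, opposite signs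
    have hsign : b.2 = !a.2 := by
      revert hne2
      cases a.2 <;> cases b.2 <;> decide
    have : FreeGroup.mk [b] = (FreeGroup.mk [a])⁻¹ := by
      rw [FreeGroup.inv_mk]
      obtain ⟨a1, a2⟩ := a
      obtain ⟨b1, b2⟩ := b
      simp only at hab hsign
      subst hab; subst hsign
      rfl
    rw [this, map_inv]
  have heq : pv g w 1 = pv g w (w.length - 1) := by rw [h1, h2, hab']
  rcases Nat.lt_or_ge 1 (w.length - 1) with hlt | hge
  · exact hinj 1 (w.length - 1) hlt (by omega) heq
  · -- length `2`: `w = [b, a]` with `a`, `b` cancelling is not reduced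
    have hlen2 : w.length = 2 := by omega
    rcases w with _ | ⟨x, _ | ⟨y, _ | ⟨z, t⟩⟩⟩
    · simp at hlen2
    · simp at hlen2
    · simp only [List.head?_cons, Option.some.injEq] at hb'
      simp only [List.getLast?_cons_cons, List.getLast?_singleton, Option.some.injEq] at ha'
      subst hb'; subst ha'
      have hstep := hred
      rw [FreeGroup.IsReduced] at hstep
      simp only [List.isChain_cons_cons, List.isChain_singleton, and_true] at hstep
      have h3 : x.2 = y.2 := hstep hab.symm
      exact hne2 h3.symm
    · simp at hlen2

/-- Prefix of a rotation, first range: `(w.rotate k).take i = (w.drop k).take i` for `i ≤ n - k`.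
[folklore] -/
theorem take_rotate_of_le {α : Type*} (w : List α) {k i : ℕ} (hk : k ≤ w.length) (hi : i ≤ w.length - k) :
    (w.rotate k).take i = (w.drop k).take i := by
  rw [List.rotate_eq_drop_append_take hk, List.take_append_of_le_length (by simpa using hi)]

/-- Prefix of a rotation, second range: for `n - k ≤ i`,
`(w.rotate k).take i = w.drop k ++ w.take (i - (n - k))`. [folklore] -/
theorem take_rotate_of_ge {α : Type*} (w : List α) {k i : ℕ} (hk : k ≤ w.length) (hi : w.length - k ≤ i) :
    (w.rotate k).take i = w.drop k ++ w.take (min (i - (w.length - k)) k) := by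
  rw [List.rotate_eq_drop_append_take hk, List.take_append, List.take_of_length_le (by simpa using hi),
    List.take_take]
  congr 1
  simp

/-- **Prefix vertices of a rotation**: `pv (w.rotate k) i = (pv w k)⁻¹ * pv w ((k + i) mod n)` for a
closed word `w`, `k < n`, `i < n`. [folklore] -/
theorem pv_rotate {w : List (surfaceGen g × Bool)} (hw : proj g (FreeGroup.mk w) = 1) {k i : ℕ}
    (hk : k < w.length) (hi : i < w.length) :
    pv g (w.rotate k) i = (pv g w k)⁻¹ * pv g w ((k + i) % w.length) := by
  rcases Nat.lt_or_ge i (w.length - k) with hlt | hge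
  · rw [pv, take_rotate_of_le w hk.le hlt.le, Nat.mod_eq_of_lt (by omega), pv, pv, List.take_add,
      mk_append, map_mul, inv_mul_cancel_left]
  · rw [pv, take_rotate_of_ge w hk.le hge, mk_append, map_mul, pv, pv]
    have hmod : (k + i) % w.length = i - (w.length - k) := by
      rw [show k + i = (i - (w.length - k)) + w.length by omega, Nat.add_mod_right,
        Nat.mod_eq_of_lt (by omega)]
    rw [hmod, min_eq_left (by omega)]
    -- `mk (drop k) = (mk (take k))⁻¹ * mk w`
    have e : FreeGroup.mk (w.drop k) = (FreeGroup.mk (w.take k))⁻¹ * FreeGroup.mk w := by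
      rw [eq_inv_mul_iff_mul_eq, ← mk_append, List.take_append_drop]
    rw [e, map_mul, map_inv, hw, mul_one]

/-- **Rotations of simple circuits are simple circuits** (`SimpleCircuitRotate g` of the CORE
frame). [cite: ZieschangVogtColdewey1980, 5.3.1 (c)] -/
theorem simpleCircuitRotate_holds (g : ℕ) : SimpleCircuitRotate g := by
  intro w k hw
  -- reduce to `k < n`
  rw [← List.rotate_mod]
  set k' := k % w.length with hk'
  have hn : 0 < w.length := List.length_pos_iff.2 hw.1
  have hk : k' < w.length := Nat.mod_lt _ hn
  obtain ⟨hne, hred, hcl, hinj⟩ := hw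
  have hcyc := (IsSimpleCircuit.isCyclicallyReduced ⟨hne, hred, hcl, hinj⟩)
  refine ⟨?_, ?_, ?_, ?_⟩
  · intro h
    have := congrArg List.length h
    simp only [List.length_rotate, List.length_nil] at this
    exact hne (List.length_eq_zero_iff.1 this)
  · -- reducedness of a rotation of a cyclically reduced word
    rcases Nat.eq_zero_or_pos k' with h0 | hpos
    · rw [h0, List.rotate_zero]; exact hred
    · rw [List.rotate_eq_drop_append_take hk.le]
      -- `w = take k' ++ drop k'`; the junction letters of `drop ++ take` are the last letter of
      -- `w` and the first letter of `w`, which do not cancel by cyclic reducedness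
      have hw' : w = w.take k' ++ w.drop k' := (List.take_append_drop k' w).symm
      have hdrop : FreeGroup.IsReduced (w.drop k') := hred.infix (List.drop_suffix _ _).isInfix
      have htake : FreeGroup.IsReduced (w.take k') := hred.infix (List.take_prefix _ _).isInfix
      rw [FreeGroup.IsReduced, List.isChain_append]
      refine ⟨hdrop, htake, ?_⟩
      intro x hx y hy hxy
      -- `x` is the last letter of `w`, `y` the first letter of `w`
      have hxlast : x ∈ w.getLast? := by
        rw [hw', List.getLast?_append, hx]; simp
      have hyhead : y ∈ w.head? := by
        have : (w.take k').head? = w.head? := by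
          rw [List.head?_take, if_neg (by omega)]
        rw [← this]; exact hy
      exact hcyc.2 x hxlast y hyhead hxy
  · obtain ⟨d, hd⟩ : ∃ d : FreeGroup (surfaceGen g), FreeGroup.mk (w.rotate k') =
        d * FreeGroup.mk w * d⁻¹ := by
      rw [List.rotate_eq_drop_append_take hk.le]
      refine ⟨(FreeGroup.mk (w.take k'))⁻¹, ?_⟩
      have : FreeGroup.mk w = FreeGroup.mk (w.take k') * FreeGroup.mk (w.drop k') := by
        rw [← mk_append, List.take_append_drop]
      rw [mk_append, this]; group
    rw [hd, map_mul, map_mul, map_inv, hcl, mul_one, mul_inv_cancel]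
  · intro i j hij hj heq
    rw [List.length_rotate] at hj
    have hi : i < w.length := lt_trans hij hj
    change pv g (w.rotate k') i = pv g (w.rotate k') j at heq
    rw [pv_rotate hcl hk hi, pv_rotate hcl hk hj] at heq
    have heq' : pv g w ((k' + i) % w.length) = pv g w ((k' + j) % w.length) := mul_left_cancel heq
    -- injectivity of `pv w` on `[0, n)` (with `pv w n = pv w 0`)
    have key : ∀ a b : ℕ, a < w.length → b < w.length → pv g w a = pv g w b → a = b := by
      intro a b ha hb hab
      rcases lt_trichotomy a b with h | h | h
      · exact absurd hab (hinj a b h hb)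
      · exact h
      · exact absurd hab.symm (hinj b a h ha)
    have hmod := key _ _ (Nat.mod_lt _ hn) (Nat.mod_lt _ hn) heq'
    -- `(k'+i) % n = (k'+j) % n` with `i < j < n` is impossible
    have : (k' + i) % w.length ≠ (k' + j) % w.length := by
      intro h
      have h1 : (k' + j - (k' + i)) % w.length = 0 := by
        rw [Nat.sub_mod_eq_zero_of_mod_eq h.symm]
      have h2 : (k' + j - (k' + i)) % w.length = j - i := by
        rw [show k' + j - (k' + i) = j - i by omega, Nat.mod_eq_of_lt (by omega)]
      omega
    exact this hmod

end SurfaceGroup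

end Literature.Topology.FourManifolds

end
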